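import Summits.NavierStokesRegularity.NavierStokesRegularity.Theorems.OddMorawetzLocal.Negative.OddMorawetzLocalRefutationData5
import Summits.NavierStokesRegularity.NavierStokesRegularity.Theorems.OddMorawetzLocal.Negative.OddMorawetzLocalRefutationDefsV
import HarnessLib

/-!
# Crux `OddMorawetzLocal` (stmt-NavierStokesRegularity-1376) — kernel certificates, weight 5 (part D2)

The finite computations of the weight-5 half of the refutation, each a closed Boolean evaluated by the kernel
(`decide +kernel`) on the vocabulary of `OddMorawetzLocalJetAlgebra` / `…RefutationDefs{,Fast,IV,V}` and the literal
data of `…RefutationData5`.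
Parts D1–D3: `cert5_iso_recon_*` — every isotropic basis polynomial is the combination of normalised orbit sums given by
its orbit coordinates.
Chunks of two descriptors per theorem (kernel memory). No analysis; lands `--supports` the crux item.
-/

set_option linter.dupNamespace false

namespace Summit.NavierStokesRegularity.NavierStokesRegularity.Theorems.OddMorawetz

/-- Isotropic basis elements `18`, `19`: reconstructed from their orbit coordinates. -/
theorem cert5_iso_recon_9 : (((isoDesc5.drop 18).take 2).all fun d => orbitReconF reps5 (isoPolyF d)) = true := by
  decide +kernel

/-- Isotropic basis elements `20`, `21`: reconstructed from their orbit coordinates. -/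
theorem cert5_iso_recon_10 : (((isoDesc5.drop 20).take 2).all fun d => orbitReconF reps5 (isoPolyF d)) = true := by
  decide +kernel

/-- Isotropic basis elements `22`, `23`: reconstructed from their orbit coordinates. -/
theorem cert5_iso_recon_11 : (((isoDesc5.drop 22).take 2).all fun d => orbitReconF reps5 (isoPolyF d)) = true := by
  decide +kernel

/-- Isotropic basis elements `24`, `25`: reconstructed from their orbit coordinates. -/
theorem cert5_iso_recon_12 : (((isoDesc5.drop 24).take 2).all fun d => orbitReconF reps5 (isoPolyF d)) = true := by
  decide +kernel

/-- Isotropic basis elements `26`, `27`: reconstructed from their orbit coordinates. -/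
theorem cert5_iso_recon_13 : (((isoDesc5.drop 26).take 2).all fun d => orbitReconF reps5 (isoPolyF d)) = true := by
  decide +kernel

/-- Isotropic basis elements `28`, `29`: reconstructed from their orbit coordinates. -/
theorem cert5_iso_recon_14 : (((isoDesc5.drop 28).take 2).all fun d => orbitReconF reps5 (isoPolyF d)) = true := by
  decide +kernel

/-- Isotropic basis elements `30`, `31`: reconstructed from their orbit coordinates. -/
theorem cert5_iso_recon_15 : (((isoDesc5.drop 30).take 2).all fun d => orbitReconF reps5 (isoPolyF d)) = true := by
  decide +kernel

/-- Isotropic basis elements `32`, `33`: reconstructed from their orbit coordinates. -/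
theorem cert5_iso_recon_16 : (((isoDesc5.drop 32).take 2).all fun d => orbitReconF reps5 (isoPolyF d)) = true := by
  decide +kernel

/-- Isotropic basis elements `34`, `35`: reconstructed from their orbit coordinates. -/
theorem cert5_iso_recon_17 : (((isoDesc5.drop 34).take 2).all fun d => orbitReconF reps5 (isoPolyF d)) = true := by
  decide +kernel

end Summit.NavierStokesRegularity.NavierStokesRegularity.Theorems.OddMorawetz
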